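import Literature.NumberTheory.EllipticCurves.ModularFormsGamma0FreeModule
import Literature.NumberTheory.ModularForms.SturmCongruenceNorm
import HarnessLib

/-!
# Values at the cusp of quotients of holomorphic forms, and their transport under `Aut(ℂ)` (toward Stevens 1982 Thm 1.3.1 (b))
(route `ManinLocalTwoThree`, crux C2 `ManinOddAtFour` stmt-BirchSwinnertonDyer-22967; cell bsd-f2-manin, prover seat p1 gen 22;
`--supports stmt-BirchSwinnertonDyer-22967`)

For two holomorphic `h`-periodic bounded functions `A, H` on `ℍ` (`H` with nonzero `q_h`-expansion) the behaviour of `A/H` at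
`i∞` is read off the `q_h`-expansions: with `n₀` the order of `H`, `A/H → a_{n₀}/h_{n₀}` if `a_i = 0` for `i < n₀`, and
`|A/H| → ∞` if some `a_i ≠ 0`, `i < n₀` (Diamond–Shurman §1.1/§3.2: orders of meromorphic modular functions at `∞`; the tree's
`QExpansionCuspOrder` does the period `1`).  Consequently, if a ring endomorphism `σ` of `ℂ` carries the expansions of `A, H` to those
of `A', H'` (coefficientwise), then **`A/H → ℓ` implies `A'/H' → σ(ℓ)`**, and **`|A/H| → ∞` implies `|A'/H'| → ∞`**
(`tendsto_div_of_conj`, `tendsto_norm_div_atTop_of_conj`) — the transport of cusp values used for the Galois action on the cusp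
values of a modular parametrisation (Stevens 1982, Thm. 1.3.1).

* `tendsto_div_qParam_pow_coeff` — `A(τ)/q_h(τ)^{n} → a_n` when `a_i = 0` for `i < n`;
* `tendsto_div_of_coeff_eq_zero`, `tendsto_norm_div_atTop_of_coeff_ne_zero` — the dichotomy for `A/H`;
* `tendsto_div_of_conj`, `tendsto_norm_div_atTop_of_conj` — transport under `σ`, for members of `formSpace Γ(N) k`.

No definitions, no sorry.  BSD is not proved by this file; C2 is not proved by this file.
[cite: DiamondShurman2005, §1.1 and §3.2] [cite: Stevens1982, §1.3 Thm. 1.3.1]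
-/

set_option linter.dupNamespace false
set_option autoImplicit false

noncomputable section

open Complex Filter Topology Set Function PowerSeries
open UpperHalfPlane hiding I
open scoped Real Topology Manifold MatrixGroups ModularForm
open ModularForm CongruenceSubgroup
open Literature.NumberTheory.EllipticCurves.ModularForms

namespace Summit.BirchSwinnertonDyer.BirchSwinnertonDyer.Theorems.ManinLocalTwoThree.StevensGalois

/-! ## §1 Leading behaviour at the cusp -/

section Growth

variable {h : ℝ} {φ ψ : ℍ → ℂ}

/-- **Leading behaviour at the cusp**: for `φ` holomorphic, `h`-periodic, bounded at `i∞`, and `n` such that the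
`q_h`-coefficients of index `< n` vanish, `φ(τ)/q_h(τ)^n → a_n` as `im τ → ∞`. [cite: DiamondShurman2005, §1.1] -/
theorem tendsto_div_qParam_pow_coeff (hh : 0 < h) (hper : Periodic (φ ∘ ofComplex) h) (hmd : MDiff φ)
    (hbd : IsBoundedAtImInfty φ) (n : ℕ) (hlt : ∀ i < n, (qExpansion h φ).coeff i = 0) :
    Tendsto (fun τ : ℍ ↦ φ τ / Periodic.qParam h τ ^ n) atImInfty (𝓝 ((qExpansion h φ).coeff n)) := by
  set Φ := cuspFunction h φ with hΦ
  set c : ℕ → ℂ := fun m ↦ coeff m (qExpansion h φ) with hc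
  have hΦa : AnalyticAt ℂ Φ 0 := analyticAt_cuspFunction_zero hh hper hmd hbd
  have hsum : ∀ τ : ℍ, HasSum (fun m ↦ c m • Periodic.qParam h τ ^ m) (φ τ) := fun τ ↦
    hasSum_qExpansion hh hper hmd hbd τ
  set p : FormalMultilinearSeries ℂ ℂ ℂ := FormalMultilinearSeries.ofScalars ℂ c with hp
  have hps : HasFPowerSeriesAt Φ p 0 := (hasFPowerSeriesOnBall_cuspFunction hh hΦa hsum).hasFPowerSeriesAt
  -- factorisation `Φ = q^n g`, `g` continuous at `0` with `g 0 = a_n`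
  set g : ℂ → ℂ := (swap dslope (0 : ℂ))^[n] Φ with hg
  have hgps := hps.has_fpower_series_iterate_dslope_fslope n
  have hgval : ∀ k, ((swap dslope (0 : ℂ))^[k] Φ) 0 = c k := fun k ↦ by
    rw [← (hps.has_fpower_series_iterate_dslope_fslope k).coeff_zero 1, ← FormalMultilinearSeries.coeff,
      FormalMultilinearSeries.coeff_iterate_fslope, zero_add, hp]
    simp
  have hg0 : g 0 = c n := hgval n
  have hgc : ContinuousAt g 0 := hgps.continuousAt
  have hfac : ∀ z, Φ z = z ^ n * g z := fun z ↦ by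
    have := pow_sub_smul_iterate_dslope_of_zero (f := Φ) (a := (0 : ℂ)) n (fun k hk ↦ by rw [hgval k]; exact hlt k hk) z
    simpa [sub_zero, smul_eq_mul] using this.symm
  have hq : Tendsto (fun τ : ℍ ↦ Periodic.qParam h τ) atImInfty (𝓝 0) := qParam_tendsto_atImInfty hh
  have hlim : Tendsto (fun τ : ℍ ↦ g (Periodic.qParam h τ)) atImInfty (𝓝 (g 0)) := hgc.tendsto.comp hq
  rw [show (qExpansion h φ).coeff n = g 0 from hg0.symm]
  refine hlim.congr fun τ ↦ ?_
  have hqne : Periodic.qParam h τ ≠ 0 := by simp [Periodic.qParam, Complex.exp_ne_zero]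
  rw [show φ τ = Φ (Periodic.qParam h τ) from (eq_cuspFunction τ hh.ne' hper).symm, hfac,
    mul_div_cancel_left₀ _ (pow_ne_zero _ hqne)]

/-- The least index of a nonzero coefficient of a nonzero power series exists (classical bookkeeping). [folklore] -/
private theorem exists_least_coeff_ne_zero {P : PowerSeries ℂ} (hP : P ≠ 0) :
    ∃ n : ℕ, P.coeff n ≠ 0 ∧ ∀ i < n, P.coeff i = 0 := by
  classical
  have hex : ∃ m, P.coeff m ≠ 0 := by
    by_contra! hall
    exact hP (PowerSeries.ext fun m ↦ by rw [hall m, map_zero])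
  refine ⟨Nat.find hex, Nat.find_spec hex, fun i hi ↦ ?_⟩
  have := Nat.find_min hex hi
  simpa using this

/-- **Quotients converge at the cusp** when the numerator's coefficients vanish below the order `n₀` of the denominator:
`A/H → a_{n₀}/h_{n₀}`. [cite: DiamondShurman2005, §3.2] -/
theorem tendsto_div_of_coeff_eq_zero (hh : 0 < h) (hφper : Periodic (φ ∘ ofComplex) h) (hφmd : MDiff φ)
    (hφbd : IsBoundedAtImInfty φ) (hψper : Periodic (ψ ∘ ofComplex) h) (hψmd : MDiff ψ) (hψbd : IsBoundedAtImInfty ψ)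
    (n₀ : ℕ) (hψn : (qExpansion h ψ).coeff n₀ ≠ 0) (hψlt : ∀ i < n₀, (qExpansion h ψ).coeff i = 0)
    (hφlt : ∀ i < n₀, (qExpansion h φ).coeff i = 0) :
    Tendsto (fun τ : ℍ ↦ φ τ / ψ τ) atImInfty (𝓝 ((qExpansion h φ).coeff n₀ / (qExpansion h ψ).coeff n₀)) := by
  have hφlim := tendsto_div_qParam_pow_coeff hh hφper hφmd hφbd n₀ hφlt
  have hψlim := tendsto_div_qParam_pow_coeff hh hψper hψmd hψbd n₀ hψlt
  refine (hφlim.div hψlim hψn).congr' ?_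
  filter_upwards [hψlim.eventually_ne hψn] with τ hψτ
  have hqne : Periodic.qParam h τ ^ n₀ ≠ 0 := pow_ne_zero _ (by simp [Periodic.qParam, Complex.exp_ne_zero])
  have hψ0 : ψ τ ≠ 0 := fun h0 ↦ hψτ (by rw [h0, zero_div])
  simp only [Pi.div_apply]
  field_simp

/-- **Quotients blow up at the cusp** when the numerator has a nonzero coefficient below the order `n₀` of the denominator.
[cite: DiamondShurman2005, §3.2] -/
theorem tendsto_norm_div_atTop_of_coeff_ne_zero (hh : 0 < h) (hφper : Periodic (φ ∘ ofComplex) h) (hφmd : MDiff φ)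
    (hφbd : IsBoundedAtImInfty φ) (hψper : Periodic (ψ ∘ ofComplex) h) (hψmd : MDiff ψ) (hψbd : IsBoundedAtImInfty ψ)
    (n₀ : ℕ) (hψn : (qExpansion h ψ).coeff n₀ ≠ 0) (hψlt : ∀ i < n₀, (qExpansion h ψ).coeff i = 0)
    (hφex : ∃ i < n₀, (qExpansion h φ).coeff i ≠ 0) :
    Tendsto (fun τ : ℍ ↦ ‖φ τ / ψ τ‖) atImInfty atTop := by
  classical
  -- the least nonzero coefficient of `φ`, at an index `i₀ < n₀`
  obtain ⟨i₀, hi₀ne, hi₀lt⟩ : ∃ i₀, (qExpansion h φ).coeff i₀ ≠ 0 ∧ ∀ i < i₀, (qExpansion h φ).coeff i = 0 :=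
    exists_least_coeff_ne_zero (fun h0 ↦ by obtain ⟨i, -, hi⟩ := hφex; exact hi (by rw [h0, map_zero]))
  obtain ⟨i₁, hi₁, hi₁ne⟩ := hφex
  have hi₀n : i₀ < n₀ := by
    by_contra hle
    exact hi₁ne (hi₀lt i₁ (lt_of_lt_of_le hi₁ (not_lt.mp hle)))
  have hφlim := tendsto_div_qParam_pow_coeff hh hφper hφmd hφbd i₀ hi₀lt
  -- `ψ/q^{i₀} → 0` (the coefficient of index `i₀ < n₀` vanishes), nonzero eventually
  have hψlim := tendsto_div_qParam_pow_coeff hh hψper hψmd hψbd i₀ (fun i hi ↦ hψlt i (hi.trans hi₀n))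
  rw [hψlt i₀ hi₀n] at hψlim
  have hψlim' := tendsto_div_qParam_pow_coeff hh hψper hψmd hψbd n₀ hψlt
  have hψne : ∀ᶠ τ : ℍ in atImInfty, ψ τ ≠ 0 := by
    filter_upwards [hψlim'.eventually_ne hψn] with τ hτ h0
    exact hτ (by rw [h0, zero_div])
  have hqne : ∀ τ : ℍ, Periodic.qParam h τ ≠ 0 := fun τ ↦ by simp [Periodic.qParam, Complex.exp_ne_zero]
  -- `‖ψ/q^{i₀}‖ → 0⁺`
  have hψn0 : Tendsto (fun τ : ℍ ↦ ‖ψ τ / Periodic.qParam h τ ^ i₀‖) atImInfty (𝓝[>] 0) := by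
    refine tendsto_nhdsWithin_iff.mpr ⟨by simpa using hψlim.norm, ?_⟩
    filter_upwards [hψne] with τ hτ
    exact norm_pos_iff.mpr (div_ne_zero hτ (pow_ne_zero _ (hqne τ)))
  have hinv : Tendsto (fun τ : ℍ ↦ ‖ψ τ / Periodic.qParam h τ ^ i₀‖⁻¹) atImInfty atTop :=
    tendsto_inv_nhdsGT_zero.comp hψn0
  have hpos : 0 < ‖(qExpansion h φ).coeff i₀‖ := norm_pos_iff.mpr hi₀ne
  have := Filter.Tendsto.pos_mul_atTop hpos hφlim.norm hinv
  apply this.congr'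
  filter_upwards [hψne] with τ hψτ
  rw [← norm_inv, ← norm_mul]
  congr 1
  field_simp [pow_ne_zero _ (hqne τ)]

end Growth

/-! ## §2 Transport of cusp values under a ring endomorphism of `ℂ` -/

section Transport

variable {N : ℕ} [NeZero N] (σ : ℂ →+* ℂ) {k : ℤ} {A H A' H' : ℍ → ℂ}

/-- Members of `formSpace Γ(N) k` are `N`-periodic, holomorphic and bounded at `i∞`. [folklore] -/
private theorem periodic_mdiff_bdd_of_mem (hA : A ∈ formSpace (CongruenceSubgroup.Gamma N : Subgroup (GL (Fin 2) ℝ)) k) :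
    Periodic (A ∘ ofComplex) (N : ℝ) ∧ MDiff A ∧ IsBoundedAtImInfty A := by
  obtain ⟨F, rfl⟩ := hA
  exact ⟨SlashInvariantFormClass.periodic_comp_ofComplex F (Literature.NumberTheory.ModularForms.natCast_mem_strictPeriods_Gamma N),
    ModularFormClass.holo F, ModularFormClass.bdd_at_infty F⟩

/-- **Transport of a finite cusp value.**  If `σ` carries the `q_N`-expansions of `A, H ∈ M_k(Γ(N))` (`H ≢ 0`) to those of
`A', H' ∈ M_k(Γ(N))` and `A/H → ℓ` at `i∞`, then `A'/H' → σ(ℓ)`. [cite: Stevens1982, §1.3 Thm. 1.3.1] [cite: DiamondShurman2005, §3.2] -/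
theorem tendsto_div_of_conj (hA : A ∈ formSpace (CongruenceSubgroup.Gamma N : Subgroup (GL (Fin 2) ℝ)) k)
    (hH : H ∈ formSpace (CongruenceSubgroup.Gamma N : Subgroup (GL (Fin 2) ℝ)) k)
    (hA' : A' ∈ formSpace (CongruenceSubgroup.Gamma N : Subgroup (GL (Fin 2) ℝ)) k)
    (hH' : H' ∈ formSpace (CongruenceSubgroup.Gamma N : Subgroup (GL (Fin 2) ℝ)) k)
    (hH0 : H ≠ 0) (hcA : qExpansion (N : ℝ) A' = (qExpansion (N : ℝ) A).map σ)
    (hcH : qExpansion (N : ℝ) H' = (qExpansion (N : ℝ) H).map σ) {ℓ : ℂ}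
    (hlim : Tendsto (fun τ : ℍ ↦ A τ / H τ) atImInfty (𝓝 ℓ)) :
    Tendsto (fun τ : ℍ ↦ A' τ / H' τ) atImInfty (𝓝 (σ ℓ)) := by
  have hN : (0 : ℝ) < N := Nat.cast_pos.mpr (NeZero.pos N)
  obtain ⟨hAp, hAm, hAb⟩ := periodic_mdiff_bdd_of_mem hA
  obtain ⟨hHp, hHm, hHb⟩ := periodic_mdiff_bdd_of_mem hH
  obtain ⟨hA'p, hA'm, hA'b⟩ := periodic_mdiff_bdd_of_mem hA'
  obtain ⟨hH'p, hH'm, hH'b⟩ := periodic_mdiff_bdd_of_mem hH'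
  have hqH0 : qExpansion (N : ℝ) H ≠ 0 := by
    obtain ⟨F, rfl⟩ := hH
    intro h0
    exact hH0 (congrArg DFunLike.coe ((ModularForm.qExpansion_eq_zero_iff hN
      (Literature.NumberTheory.ModularForms.natCast_mem_strictPeriods_Gamma N) F).mp h0))
  obtain ⟨n₀, hn₀, hlt⟩ := exists_least_coeff_ne_zero hqH0
  -- the numerator's low coefficients vanish (else `|A/H| → ∞`)
  have hAlt : ∀ i < n₀, (qExpansion (N : ℝ) A).coeff i = 0 := by
    by_contra! hex
    obtain ⟨i, hi, hine⟩ := hex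
    have hinf := tendsto_norm_div_atTop_of_coeff_ne_zero hN hAp hAm hAb hHp hHm hHb n₀ hn₀ hlt ⟨i, hi, hine⟩
    have hfin : Tendsto (fun τ : ℍ ↦ ‖A τ / H τ‖) atImInfty (𝓝 ‖ℓ‖) := hlim.norm
    exact not_tendsto_nhds_of_tendsto_atTop hinf ‖ℓ‖ hfin
  have hlim₀ := tendsto_div_of_coeff_eq_zero hN hAp hAm hAb hHp hHm hHb n₀ hn₀ hlt hAlt
  have hℓ : ℓ = (qExpansion (N : ℝ) A).coeff n₀ / (qExpansion (N : ℝ) H).coeff n₀ := tendsto_nhds_unique hlim hlim₀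
  -- the same data for `A', H'`
  have hn₀' : (qExpansion (N : ℝ) H').coeff n₀ ≠ 0 := by
    rw [hcH, coeff_map]
    exact fun h0 ↦ hn₀ (σ.injective (by rw [h0, map_zero]))
  have hlt' : ∀ i < n₀, (qExpansion (N : ℝ) H').coeff i = 0 := fun i hi ↦ by rw [hcH, coeff_map, hlt i hi, map_zero]
  have hAlt' : ∀ i < n₀, (qExpansion (N : ℝ) A').coeff i = 0 := fun i hi ↦ by rw [hcA, coeff_map, hAlt i hi, map_zero]
  have hlim' := tendsto_div_of_coeff_eq_zero hN hA'p hA'm hA'b hH'p hH'm hH'b n₀ hn₀' hlt' hAlt'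
  rw [hcA, hcH, coeff_map, coeff_map, ← map_div₀, ← hℓ] at hlim'
  exact hlim'

/-- **Transport of a pole at the cusp.**  Under the same conjugation hypotheses, `|A/H| → ∞` at `i∞` implies `|A'/H'| → ∞`.
[cite: Stevens1982, §1.3 Thm. 1.3.1] [cite: DiamondShurman2005, §3.2] -/
theorem tendsto_norm_div_atTop_of_conj (hA : A ∈ formSpace (CongruenceSubgroup.Gamma N : Subgroup (GL (Fin 2) ℝ)) k)
    (hH : H ∈ formSpace (CongruenceSubgroup.Gamma N : Subgroup (GL (Fin 2) ℝ)) k)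
    (hA' : A' ∈ formSpace (CongruenceSubgroup.Gamma N : Subgroup (GL (Fin 2) ℝ)) k)
    (hH' : H' ∈ formSpace (CongruenceSubgroup.Gamma N : Subgroup (GL (Fin 2) ℝ)) k)
    (hH0 : H ≠ 0) (hcA : qExpansion (N : ℝ) A' = (qExpansion (N : ℝ) A).map σ)
    (hcH : qExpansion (N : ℝ) H' = (qExpansion (N : ℝ) H).map σ)
    (hlim : Tendsto (fun τ : ℍ ↦ ‖A τ / H τ‖) atImInfty atTop) :
    Tendsto (fun τ : ℍ ↦ ‖A' τ / H' τ‖) atImInfty atTop := by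
  have hN : (0 : ℝ) < N := Nat.cast_pos.mpr (NeZero.pos N)
  obtain ⟨hAp, hAm, hAb⟩ := periodic_mdiff_bdd_of_mem hA
  obtain ⟨hHp, hHm, hHb⟩ := periodic_mdiff_bdd_of_mem hH
  obtain ⟨hA'p, hA'm, hA'b⟩ := periodic_mdiff_bdd_of_mem hA'
  obtain ⟨hH'p, hH'm, hH'b⟩ := periodic_mdiff_bdd_of_mem hH'
  have hqH0 : qExpansion (N : ℝ) H ≠ 0 := by
    obtain ⟨F, rfl⟩ := hH
    intro h0
    exact hH0 (congrArg DFunLike.coe ((ModularForm.qExpansion_eq_zero_iff hN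
      (Literature.NumberTheory.ModularForms.natCast_mem_strictPeriods_Gamma N) F).mp h0))
  obtain ⟨n₀, hn₀, hlt⟩ := exists_least_coeff_ne_zero hqH0
  -- some low coefficient of `A` is nonzero (else `A/H` converges)
  have hex : ∃ i < n₀, (qExpansion (N : ℝ) A).coeff i ≠ 0 := by
    by_contra! hall
    have hfin := tendsto_div_of_coeff_eq_zero hN hAp hAm hAb hHp hHm hHb n₀ hn₀ hlt hall
    exact not_tendsto_nhds_of_tendsto_atTop hlim _ hfin.norm
  obtain ⟨i, hi, hine⟩ := hex
  have hn₀' : (qExpansion (N : ℝ) H').coeff n₀ ≠ 0 := by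
    rw [hcH, coeff_map]
    exact fun h0 ↦ hn₀ (σ.injective (by rw [h0, map_zero]))
  have hlt' : ∀ i < n₀, (qExpansion (N : ℝ) H').coeff i = 0 := fun i hi ↦ by rw [hcH, coeff_map, hlt i hi, map_zero]
  have hine' : (qExpansion (N : ℝ) A').coeff i ≠ 0 := by
    rw [hcA, coeff_map]
    exact fun h0 ↦ hine (σ.injective (by rw [h0, map_zero]))
  exact tendsto_norm_div_atTop_of_coeff_ne_zero hN hA'p hA'm hA'b hH'p hH'm hH'b n₀ hn₀' hlt' ⟨i, hi, hine'⟩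

end Transport

end Summit.BirchSwinnertonDyer.BirchSwinnertonDyer.Theorems.ManinLocalTwoThree.StevensGalois

end
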